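import Mathlib

/-!
# C4HNWindow v1.1 — the RANK LEMMA and «no numerically-split point in the WNSH-LF window»: statements (g23) AND kernel proofs (g24)
in ONE self-contained module (hsemireg-c4-1 g26; memos `C4-HNWNSH-c4-1-g23.md`, `C4-RLINF-c4-1-g24.md`, `C4-SANDWICH-WINDOW-c4-1-g26.md` §A)

Token: `line stmt-HodgeConjecture-18881 Cruxes/BlochSeedDiscOne/Lines/birth.lean 814a6a70c14e831a stub_rung_pad4_seedAt`.

HONEST SCOPE.  Nothing in this file is proved toward HC ∕ HC_CM ∕ HC_AV ∕ №4 ∕ 26512 ∕ 18881 ∕ H2, and the registered stub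
`stub_rung_pad4_seedAt` is not touched.  This is the LINEAR-ALGEBRA SHADOW of the g23 memo with the g24 kernel proofs merged in.

WHY v1.1 (g26).  v1.0 (g23, c8b9704f179d2a41) recorded `RankLemma m n`, `NoSplitWindow n`, `NSWReduction n` as NAMED PROPOSITIONS ONLY;
`C4RankLemma.lean` (g24, bfcc361037085d60) proved them over verbatim copies of the definitions in the namespace `HSemireg.C4RankLemma`,
and the announced two-import bridge `C4RankLemmaBridge.lean` (name transfer by `defeq`) could not be elaborated on the farm for three
generations (snapshot `stale:unbuilt` for both Cruxes modules, g24 ∕ g25 ∕ g26).  v1.1 removes the need for a bridge: the g24 sections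
`Core` and `Consequences` are appended VERBATIM inside this namespace (one proof term shortened: `not_splitWNSH` now goes through the g23
skeleton `not_splitWNSH_of_noSplitWindow`), so every g23 name is a theorem of its home module:
`rankLemma_all : ∀ m n, RankLemma m n`, `rankLemmaUpToFive_holds`, `rankLemmaUpToThree_holds`, `noSplitWindow_all : ∀ n, NoSplitWindow n`,
`nswReduction_all`, `not_splitWNSH` (unconditional).  The definitions of v1.0 are byte-identical; only docstrings of the four statement
`def`s were updated to say «proved below».  `C4RankLemma.lean` stays in the tree as the g24 record (same theorems, other namespace).

WHICH SURVIVOR-SPEC CLAUSE `not_splitWNSH` DISCHARGES (director R19.589): exactly g23's design rule (N2), at CLASS level and for every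
design at once — the bundle realising the window (p₁ = p₂ = p₃ = 0, p₄ ≠ 0; Δ = 4 + w + w²∕280, w ≠ 0) cannot have its Chern character
numerically split into four real (1,1) roots (no full flag ∕ iterated extension of line bundles, any order, any Pic⁰ labels; no HN∕JH
filtration with rank-1 invertible-or-codim-≥-3-defective graded pieces).  It discharges NO clause of the letter-level survivor screens
(toyPresB, SPEC-32, the (B1)-proper screens), which constrain presentations, not the Chern character of the cokernel (g24 memo §3.5).

CONTENTS.
* `minor2`, `Wedge2SumZero`, `Wedge3SumZero`, `wedge4Sum`, `SplitWNSH` : compound sums `Σ_j ∧ᵏ D_j` entrywise (the power sums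
  `p_k` of numerically split Chern roots `δ_j ↔ D_j ∈ Herm_n` in the ∧⊗∧̄ model, g23 memo §1).
* `polarized_CH_two`, `newton_p4`, `p4_eq_neg_four_e4`, `gaussian_control_*` : g23 identities and the complex-roots control.
* `RankLemma`, `RankLemmaUpToThree`, `RankLemmaUpToFive`, `NoSplitWindow`, `NSWReduction`, `not_splitWNSH_of_noSplitWindow` : g23 statements
  and logical skeleton.
* section `Core` (g24): THEOREM RL∞ — for a finite Hermitian family `E` with `Σ_j ∧²E_j = 0` the joint range `J = Σ_j range E_j` has
  `dim J ≤ dim K` for every `K ≤ ℂ^ι` containing the row vectors (`finrank_J_le`), hence `≤ |ι|` (`finrank_J_le_card`), `≤ dim span{E_j}`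
  (`finrank_J_le_rowSpace`), and `rank (Σ c_j E_j) ≤ |ι|` (`rank_sum_smul_le`).  Proof: Fact 2 (`fact2`: `y ⊥ span{E_j x}` ⟹ row spaces of
  `A_x`, `A_y` orthogonal) + greedy induction (`Inv`, `step`, `terminal`).
* section `Consequences` (g24): `rankLemma_all`, `finrank_J_le_three`, `noSplitWindow_all`, `nswReduction_all`, `not_splitWNSH`.

No `sorry`, no `axiom`, no `instance`, no `notation`, no `native_decide`, no `set_option`.
-/

namespace HSemireg.C4HNWindow

open Matrix BigOperators

section Compounds

variable {R : Type*} [CommRing R] {n : ℕ} {ι : Type*} [Fintype ι]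

/-- the 2×2 minor of `M` on rows `a,b` and columns `c,d` -/
def minor2 (M : Matrix (Fin n) (Fin n) R) (a b c d : Fin n) : R :=
  M a c * M b d - M a d * M b c

/-- the 3×3 minor of `M` on rows `r` and columns `s` (as a determinant of the submatrix; vanishes if rows or columns repeat) -/
def minor3 (M : Matrix (Fin n) (Fin n) R) (r s : Fin 3 → Fin n) : R :=
  (M.submatrix r s).det

/-- the 4×4 minor of `M` on rows `r` and columns `s` -/
def minor4 (M : Matrix (Fin n) (Fin n) R) (r s : Fin 4 → Fin n) : R :=
  (M.submatrix r s).det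

/-- `Σ_j ∧²(D j) = 0` entrywise: every 2×2-minor sum vanishes (the class condition `p₂ = Σ δ_j² = 0`). -/
def Wedge2SumZero (D : ι → Matrix (Fin n) (Fin n) R) : Prop :=
  ∀ a b c d : Fin n, ∑ j, minor2 (D j) a b c d = 0

/-- `Σ_j ∧³(D j) = 0` entrywise (the class condition `p₃ = 0`). -/
def Wedge3SumZero (D : ι → Matrix (Fin n) (Fin n) R) : Prop :=
  ∀ r s : Fin 3 → Fin n, ∑ j, minor3 (D j) r s = 0

/-- the entry `(r,s)` of `Σ_j ∧⁴(D j)` (the class `p₄ ∕ 24 = ch₄` of the split character, up to the model's sign). -/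
def wedge4Sum (D : ι → Matrix (Fin n) (Fin n) R) (r s : Fin 4 → Fin n) : R :=
  ∑ j, minor4 (D j) r s

/-- A NUMERICALLY SPLIT POINT OF THE WNSH-LF WINDOW in the ∧⊗∧̄ model (memo §1, §3): four roots `D_j` with
`p₁ = p₂ = p₃ = 0` and `p₄ ≠ 0` (some entry of `Σ∧⁴D_j` non-zero, e.g. the Weil entry `(I₀,J₀)`). -/
def SplitWNSH (D : Fin 4 → Matrix (Fin n) (Fin n) R) : Prop :=
  (∑ j, D j = 0) ∧ Wedge2SumZero D ∧ Wedge3SumZero D ∧ ∃ r s : Fin 4 → Fin n, wedge4Sum D r s ≠ 0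

end Compounds

section Identities

variable {R : Type*} [CommRing R]

/-- POLARIZED CAYLEY–HAMILTON for 2×2 matrices: `E Y E = tr(E Y)·E − det(E)·adj(Y)`.  Summing over a family `E_i` this is the
n = 2 case of identity (I′) of the memo: `Σ E_i Y E_i = Σ tr(E_i Y) E_i` iff `Σ det E_i = 0` (= `Σ∧²E_i = 0` for n = 2). -/
theorem polarized_CH_two (E Y : Matrix (Fin 2) (Fin 2) R) :
    E * Y * E = (E * Y).trace • E - E.det • Y.adjugate := by
  ext i j
  rw [Matrix.adjugate_fin_two]
  simp only [Matrix.mul_apply, Matrix.trace, Matrix.diag, Fin.sum_univ_two, Matrix.det_fin_two, Matrix.sub_apply,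
    Matrix.smul_apply, smul_eq_mul, Matrix.of_apply]
  fin_cases i <;> fin_cases j <;> simp <;> ring

/-- (I′) for n = 2, summed form: if `Σ_i det E_i = 0` then `Σ_i E_i Y E_i = Σ_i tr(E_i Y) E_i`. -/
theorem identity_Iprime_two {ι : Type*} [Fintype ι] (E : ι → Matrix (Fin 2) (Fin 2) R) (Y : Matrix (Fin 2) (Fin 2) R)
    (h : ∑ i, (E i).det = 0) :
    ∑ i, E i * Y * E i = ∑ i, (E i * Y).trace • E i := by
  have key : ∀ i, E i * Y * E i = (E i * Y).trace • E i - (E i).det • Y.adjugate := fun i => polarized_CH_two (E i) Y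
  simp_rw [key, Finset.sum_sub_distrib, ← Finset.sum_smul, h, zero_smul, sub_zero]

/-- power sums and elementary symmetric functions of four roots (explicit polynomials). -/
def p (k : ℕ) (x₁ x₂ x₃ x₄ : R) : R := x₁ ^ k + x₂ ^ k + x₃ ^ k + x₄ ^ k
/-- `e₁` -/ def e1 (x₁ x₂ x₃ x₄ : R) : R := x₁ + x₂ + x₃ + x₄
/-- `e₂` -/ def e2 (x₁ x₂ x₃ x₄ : R) : R := x₁*x₂ + x₁*x₃ + x₁*x₄ + x₂*x₃ + x₂*x₄ + x₃*x₄
/-- `e₃` -/ def e3 (x₁ x₂ x₃ x₄ : R) : R := x₁*x₂*x₃ + x₁*x₂*x₄ + x₁*x₃*x₄ + x₂*x₃*x₄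
/-- `e₄` -/ def e4 (x₁ x₂ x₃ x₄ : R) : R := x₁*x₂*x₃*x₄

/-- NEWTON's identity in degree 4 for four roots: `p₄ = e₁ p₃ − e₂ p₂ + e₃ p₁ − 4 e₄`. -/
theorem newton_p4 (x₁ x₂ x₃ x₄ : R) :
    p 4 x₁ x₂ x₃ x₄ = e1 x₁ x₂ x₃ x₄ * p 3 x₁ x₂ x₃ x₄ - e2 x₁ x₂ x₃ x₄ * p 2 x₁ x₂ x₃ x₄
      + e3 x₁ x₂ x₃ x₄ * p 1 x₁ x₂ x₃ x₄ - 4 * e4 x₁ x₂ x₃ x₄ := by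
  simp only [p, e1, e2, e3, e4]; ring

/-- In the WNSH window (`p₁ = p₂ = p₃ = 0`, memo §1) the top power sum is `p₄ = −4 e₄`; with `p₄ = 24 w` this is `e₄ = −6 w`. -/
theorem p4_eq_neg_four_e4 (x₁ x₂ x₃ x₄ : R) (h1 : p 1 x₁ x₂ x₃ x₄ = 0) (h2 : p 2 x₁ x₂ x₃ x₄ = 0)
    (h3 : p 3 x₁ x₂ x₃ x₄ = 0) : p 4 x₁ x₂ x₃ x₄ = -4 * e4 x₁ x₂ x₃ x₄ := by
  rw [newton_p4, h1, h2, h3]; ring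

/-- `p₂ = e₁² − 2 e₂`: with `p₁ = e₁ = 0`, the window condition `p₂ = 0` is `e₂ = 0` (memo §1). -/
theorem p2_eq (x₁ x₂ x₃ x₄ : R) : p 2 x₁ x₂ x₃ x₄ = e1 x₁ x₂ x₃ x₄ ^ 2 - 2 * e2 x₁ x₂ x₃ x₄ := by
  simp only [p, e1, e2]; ring

end Identities

section GaussianControl

/-- The scalar factors of the COMPLEX control roots `N_j = iʲ·B` (j = 0,1,2,3): `Σ_j (iʲ)ᵏ` vanishes for k = 1 … -/
theorem gaussian_control_k1 : (Complex.I) ^ 0 + Complex.I ^ 1 + Complex.I ^ 2 + Complex.I ^ 3 = 0 := by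
  norm_num [pow_succ, Complex.ext_iff]

/-- … for k = 2 (so `Σ∧²N_j = (Σ_j i^{2j})·∧²B = 0`) … -/
theorem gaussian_control_k2 :
    ((Complex.I) ^ 0) ^ 2 + (Complex.I ^ 1) ^ 2 + (Complex.I ^ 2) ^ 2 + (Complex.I ^ 3) ^ 2 = 0 := by
  norm_num [pow_succ, Complex.ext_iff]

/-- … and for k = 3 … -/
theorem gaussian_control_k3 :
    ((Complex.I) ^ 0) ^ 3 + (Complex.I ^ 1) ^ 3 + (Complex.I ^ 2) ^ 3 + (Complex.I ^ 3) ^ 3 = 0 := by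
  norm_num [pow_succ, Complex.ext_iff]

/-- … while `Σ_j (iʲ)⁴ = 4 ≠ 0`: over ℂ (non-Hermitian roots) the window HAS numerically split points, `Σ∧⁴N_j = 4·∧⁴B ≠ 0`
for invertible `B` (memo §2 Remark (c), §6 positive control). -/
theorem gaussian_control_k4 :
    ((Complex.I) ^ 0) ^ 4 + (Complex.I ^ 1) ^ 4 + (Complex.I ^ 2) ^ 4 + (Complex.I ^ 3) ^ 4 = 4 := by
  norm_num [pow_succ, Complex.ext_iff]

end GaussianControl

section Statements

/-- RANK LEMMA `RL(m)` in dimension `n` (g23 memo §2 pen-proved `m ≤ 5`; v1.1: KERNEL-PROVED FOR ALL `m n` below, `rankLemma_all`,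
by the g24 greedy-invariant proof of `C4RankLemma.lean` merged into this module):
Hermitian `E_1,…,E_m` with `Σ_i ∧²E_i = 0` have every real linear combination of rank ≤ m. -/
def RankLemma (m n : ℕ) : Prop :=
  ∀ E : Fin m → Matrix (Fin n) (Fin n) ℂ, (∀ i, (E i).IsHermitian) → Wedge2SumZero E →
    ∀ c : Fin m → ℝ, (∑ i, ((c i : ℂ) • E i)).rank ≤ m

/-- The self-contained pen theorem of memo §2 (Steps 0–5) as one named proposition (v1.1: a theorem, `rankLemmaUpToThree_holds`). -/
def RankLemmaUpToThree : Prop := ∀ m n : ℕ, m ≤ 3 → RankLemma m n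

/-- The pen theorem of memo §2 with Step 5′: `m ≤ 5` (v1.1: a theorem, `rankLemmaUpToFive_holds`; the LLD input is not needed). -/
def RankLemmaUpToFive : Prop := ∀ m n : ℕ, m ≤ 5 → RankLemma m n

theorem rankLemmaUpToThree_of_upToFive (h : RankLemmaUpToFive) : RankLemmaUpToThree :=
  fun m n hm => h m n (le_trans hm (by norm_num))

/-- NO SPLIT POINT IN THE WINDOW, class level (memo §3; v1.1: KERNEL-PROVED for every `n`, `noSplitWindow_all`): four Hermitian roots
with `Σ D_j = 0` and `Σ∧²D_j = 0` have `∧⁴D_j = 0` for every `j` (all 4×4 minors vanish), in every ambient dimension `n`. -/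
def NoSplitWindow (n : ℕ) : Prop :=
  ∀ D : Fin 4 → Matrix (Fin n) (Fin n) ℂ, (∀ j, (D j).IsHermitian) → (∑ j, D j = 0) → Wedge2SumZero D →
    ∀ j (r s : Fin 4 → Fin n), minor4 (D j) r s = 0

/-- COROLLARY NSW, logical skeleton (kernel-checked): under `NoSplitWindow n` no Hermitian family is a numerically split point of the
WNSH-LF window — `p₄` vanishes entrywise, so no entry of `Σ∧⁴D_j` (in particular the Weil entry) can be non-zero.  Note that the
hypothesis `p₃ = 0` of `SplitWNSH` is not even used. -/
theorem not_splitWNSH_of_noSplitWindow {n : ℕ} (h : NoSplitWindow n) (D : Fin 4 → Matrix (Fin n) (Fin n) ℂ)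
    (herm : ∀ j, (D j).IsHermitian) : ¬ SplitWNSH D := by
  rintro ⟨hsum, h2, -, r, s, hne⟩
  apply hne
  unfold wedge4Sum
  exact Finset.sum_eq_zero fun j _ => h D herm hsum h2 j r s

/-- `RankLemma 3 n → NoSplitWindow n` (memo §3); v1.1: trivially a theorem (`nswReduction_all`) since the conclusion holds outright. -/
def NSWReduction (n : ℕ) : Prop := RankLemma 3 n → NoSplitWindow n

end Statements

open scoped ComplexOrder

section Core

variable {n : ℕ} {ι : Type*} [Fintype ι] (E : ι → Matrix (Fin n) (Fin n) ℂ)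

/-- (H2) rearranged: `Σ_j E_{ac}E_{bd} = Σ_j E_{ad}E_{bc}`. -/
theorem wedge_swap (h2 : Wedge2SumZero E) (a b c d : Fin n) :
    ∑ j, E j a c * E j b d = ∑ j, E j a d * E j b c := by
  have h := h2 a b c d
  simp only [minor2, Finset.sum_sub_distrib] at h
  exact sub_eq_zero.mp h

/-- FACT 2 (memo §1): if `y ⊥ E_j x` for all `j` then `A_x A_yᴴ = 0` entrywise, i.e.
`Σ_j (E_j x)_a · conj((E_j y)_b) = 0`.  Uses (H2) once (indices `(a,d,c,b)`) and Hermitian symmetry once. -/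
theorem fact2 (hE : ∀ j, (E j).IsHermitian) (h2 : Wedge2SumZero E) {x y : Fin n → ℂ}
    (hN : ∀ j, star y ⬝ᵥ (E j *ᵥ x) = 0) (a b : Fin n) :
    ∑ j, (E j *ᵥ x) a * star ((E j *ᵥ y) b) = 0 := by
  have hx : ∀ j, (E j *ᵥ x) a = ∑ c, E j a c * x c := fun j => rfl
  have hy : ∀ j, star ((E j *ᵥ y) b) = ∑ d, E j d b * star (y d) := by
    intro j
    rw [show (E j *ᵥ y) b = ∑ d, E j b d * y d from rfl, star_sum]
    refine Finset.sum_congr rfl fun d _ => ?_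
    rw [star_mul', (hE j).apply d b]
  have hdot : ∀ j, star y ⬝ᵥ (E j *ᵥ x) = ∑ d, star (y d) * ∑ c, E j d c * x c := fun j => rfl
  calc ∑ j, (E j *ᵥ x) a * star ((E j *ᵥ y) b)
      = ∑ j, ∑ c, ∑ d, (x c * star (y d)) * (E j a c * E j d b) := by
        refine Finset.sum_congr rfl fun j _ => ?_
        rw [hx j, hy j, Finset.sum_mul_sum]
        refine Finset.sum_congr rfl fun c _ => Finset.sum_congr rfl fun d _ => ?_
        ring
    _ = ∑ c, ∑ d, (x c * star (y d)) * ∑ j, E j a c * E j d b := by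
        rw [Finset.sum_comm]
        refine Finset.sum_congr rfl fun c _ => ?_
        rw [Finset.sum_comm]
        refine Finset.sum_congr rfl fun d _ => ?_
        rw [Finset.mul_sum]
    _ = ∑ c, ∑ d, (x c * star (y d)) * ∑ j, E j a b * E j d c := by
        refine Finset.sum_congr rfl fun c _ => Finset.sum_congr rfl fun d _ => ?_
        rw [wedge_swap E h2 a d c b]
    _ = ∑ c, ∑ d, ∑ j, (x c * star (y d)) * (E j a b * E j d c) := by
        refine Finset.sum_congr rfl fun c _ => Finset.sum_congr rfl fun d _ => ?_
        rw [Finset.mul_sum]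
    _ = ∑ j, ∑ c, ∑ d, (x c * star (y d)) * (E j a b * E j d c) := by
        symm
        rw [Finset.sum_comm]
        refine Finset.sum_congr rfl fun c _ => ?_
        rw [Finset.sum_comm]
    _ = ∑ j, E j a b * (star y ⬝ᵥ (E j *ᵥ x)) := by
        refine Finset.sum_congr rfl fun j _ => ?_
        rw [hdot j, Finset.sum_comm, Finset.mul_sum]
        refine Finset.sum_congr rfl fun d _ => ?_
        rw [Finset.mul_sum, Finset.mul_sum]
        refine Finset.sum_congr rfl fun c _ => ?_
        ring
    _ = 0 := by simp [hN]

omit [Fintype ι] in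
/-- Hermitian symmetry: `star (E_j v) = star v ᵥ* E_j`. -/
theorem star_mulVec_herm (hE : ∀ j, (E j).IsHermitian) (j : ι) (v : Fin n → ℂ) :
    star (E j *ᵥ v) = star v ᵥ* E j := by
  rw [star_mulVec, (hE j).eq]

omit [Fintype ι] in
/-- FACT 1 (memo §1): `⟨v, E_j u⟩ = ⟨E_j v, u⟩`. -/
theorem dot_herm (hE : ∀ j, (E j).IsHermitian) (j : ι) (u v : Fin n → ℂ) :
    star v ⬝ᵥ (E j *ᵥ u) = star (E j *ᵥ v) ⬝ᵥ u := by
  rw [star_mulVec_herm E hE j, dotProduct_mulVec]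

/-- `A_x = [E_1 x | … | E_m x]`, the `n × ι` matrix whose columns are the `E_j x`. -/
def colMat (x : Fin n → ℂ) : Matrix (Fin n) ι ℂ := Matrix.of fun a j => (E j *ᵥ x) a

/-- row `a` of `A_x`, a vector of `ℂ^ι`. -/
def rowVec (x : Fin n → ℂ) (a : Fin n) : ι → ℂ := fun j => (E j *ᵥ x) a

/-- the row space `U_x ≤ ℂ^ι` of `A_x`. -/
def U (x : Fin n → ℂ) : Submodule ℂ (ι → ℂ) := Submodule.span ℂ (Set.range (rowVec E x))

/-- `L_x = A_xᴴ` as a linear map `ℂⁿ → ℂ^ι`; its kernel is the set of vectors normal to `x` (orthogonal to every `E_j x`). -/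
def L (x : Fin n → ℂ) : (Fin n → ℂ) →ₗ[ℂ] (ι → ℂ) := Matrix.mulVecLin (colMat E x)ᴴ

/-- the JOINT RANGE `J = Σ_j range(E_j) ≤ ℂⁿ`. -/
def J : Submodule ℂ (Fin n → ℂ) := ⨆ j, LinearMap.range (Matrix.mulVecLin (E j))

theorem finrank_U_eq (x : Fin n → ℂ) : Module.finrank ℂ (U E x) = (colMat E x).rank := by
  rw [Matrix.rank_eq_finrank_span_row]
  rfl

theorem finrank_range_L (x : Fin n → ℂ) :
    Module.finrank ℂ (LinearMap.range (L E x)) = Module.finrank ℂ (U E x) := by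
  rw [finrank_U_eq, ← Matrix.rank_conjTranspose (colMat E x)]
  rfl

omit [Fintype ι] in
theorem mem_ker_L {x y : Fin n → ℂ} :
    y ∈ LinearMap.ker (L E x) ↔ ∀ j, star (E j *ᵥ x) ⬝ᵥ y = 0 := by
  rw [LinearMap.mem_ker, funext_iff]
  rfl

omit [Fintype ι] in
theorem U_le {K : Submodule ℂ (ι → ℂ)} (hK : ∀ y a, rowVec E y a ∈ K) (y : Fin n → ℂ) : U E y ≤ K :=
  Submodule.span_le.mpr (by rintro _ ⟨a, rfl⟩; exact hK y a)

/-- (sesquilinear) orthogonality of two subspaces of `ℂ^ι` for the standard Hermitian form. -/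
def SOrth (P Q : Submodule ℂ (ι → ℂ)) : Prop := ∀ p ∈ P, ∀ q ∈ Q, p ⬝ᵥ star q = 0

theorem SOrth.symm {P Q : Submodule ℂ (ι → ℂ)} (h : SOrth P Q) : SOrth Q P := by
  intro q hq p hp
  rw [dotProduct_comm, star_dotProduct, dotProduct_comm, h p hp q hq, star_zero]

theorem sOrth_span {α β : Type*} {f : α → ι → ℂ} {g : β → ι → ℂ} (h : ∀ a b, f a ⬝ᵥ star (g b) = 0) :
    SOrth (Submodule.span ℂ (Set.range f)) (Submodule.span ℂ (Set.range g)) := by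
  intro p hp q hq
  have step1 : ∀ b, p ⬝ᵥ star (g b) = 0 := by
    intro b
    induction hp using Submodule.span_induction with
    | mem p hp =>
        obtain ⟨a, rfl⟩ := hp
        exact h a b
    | zero => exact zero_dotProduct _
    | add p₁ p₂ _ _ h₁ h₂ => rw [add_dotProduct, h₁, h₂, add_zero]
    | smul c p _ hp => rw [smul_dotProduct, hp, smul_zero]
  induction hq using Submodule.span_induction with
  | mem q hq =>
      obtain ⟨b, rfl⟩ := hq
      exact step1 b
  | zero => rw [star_zero, dotProduct_zero]
  | add q₁ q₂ _ _ h₁ h₂ => rw [star_add, dotProduct_add, h₁, h₂, add_zero]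
  | smul c q _ hq' => rw [star_smul, dotProduct_smul, hq', smul_zero]

theorem sOrth_sup {P Z Q : Submodule ℂ (ι → ℂ)} (h₁ : SOrth P Z) (h₂ : SOrth P Q) : SOrth P (Z ⊔ Q) := by
  intro p hp r hr
  obtain ⟨z, hz, q, hq, rfl⟩ := Submodule.mem_sup.mp hr
  rw [star_add, dotProduct_add, h₁ p hp z hz, h₂ p hp q hq, add_zero]

theorem finrank_sup_of_sOrth {P Q : Submodule ℂ (ι → ℂ)} (h : SOrth P Q) :
    Module.finrank ℂ ↥(P ⊔ Q) = Module.finrank ℂ P + Module.finrank ℂ Q := by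
  have hinf : P ⊓ Q = ⊥ := by
    rw [Submodule.eq_bot_iff]
    intro v hv
    obtain ⟨hvP, hvQ⟩ := Submodule.mem_inf.mp hv
    exact dotProduct_self_star_eq_zero.mp (h v hvP v hvQ)
  have key := Submodule.finrank_sup_add_finrank_inf_eq P Q
  rw [hinf, finrank_bot, add_zero] at key
  exact key

/-- INVARIANT of the greedy induction (memo §1): `N` = vectors normal to every point chosen so far, `Z` = orthogonal sum of
their row spaces, `K` = the ambient bound. -/
structure Inv (K : Submodule ℂ (ι → ℂ)) (N : Submodule ℂ (Fin n → ℂ)) (Z : Submodule ℂ (ι → ℂ)) : Prop where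
  dim : n ≤ Module.finrank ℂ N + Module.finrank ℂ Z
  orth : ∀ y ∈ N, SOrth (U E y) Z
  le : Z ≤ K

theorem inv_init (K : Submodule ℂ (ι → ℂ)) : Inv E K ⊤ ⊥ where
  dim := by simp
  orth := by
    intro y _ p _ q hq
    rw [(Submodule.mem_bot ℂ).mp hq, star_zero, dotProduct_zero]
  le := bot_le

/-- TERMINAL STATE: if every `y ∈ N` is killed by all `E_j`, then `J ∩ N = 0` and `dim J ≤ dim Z`. -/
theorem terminal (hE : ∀ j, (E j).IsHermitian) {K : Submodule ℂ (ι → ℂ)} {N : Submodule ℂ (Fin n → ℂ)}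
    {Z : Submodule ℂ (ι → ℂ)} (hI : Inv E K N Z) (hterm : ∀ y ∈ N, ∀ j, E j *ᵥ y = 0) :
    Module.finrank ℂ (J E) ≤ Module.finrank ℂ Z := by
  have hinf : J E ⊓ N = ⊥ := by
    rw [Submodule.eq_bot_iff]
    intro v hv
    obtain ⟨hvJ, hvN⟩ := Submodule.mem_inf.mp hv
    have hv0 : ∀ j, E j *ᵥ v = 0 := hterm v hvN
    have key : ∀ w ∈ J E, star v ⬝ᵥ w = 0 := by
      intro w hw
      refine Submodule.iSup_induction (motive := fun w => star v ⬝ᵥ w = 0) _ hw ?_ ?_ ?_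
      · intro j w hw'
        obtain ⟨u, rfl⟩ := LinearMap.mem_range.mp hw'
        rw [Matrix.mulVecLin_apply, dot_herm E hE j u v, hv0 j, star_zero, zero_dotProduct]
      · exact dotProduct_zero _
      · intro w₁ w₂ h₁ h₂
        rw [dotProduct_add, h₁, h₂, add_zero]
    exact dotProduct_star_self_eq_zero.mp (key v hvJ)
  have h1 := Submodule.finrank_sup_add_finrank_inf_eq (J E) N
  rw [hinf, finrank_bot, add_zero] at h1
  have h2 : Module.finrank ℂ ↥(J E ⊔ N) ≤ n := (Submodule.finrank_le _).trans (Module.finrank_fin_fun ℂ).le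
  have h3 := hI.dim
  omega

/-- INDUCTION STEP: a point `y₀ ∈ N` with `A_{y₀} ≠ 0` lets `Z` grow by `U_{y₀}` (dimension ≥ 1) while the invariant persists. -/
theorem step (hE : ∀ j, (E j).IsHermitian) (h2 : Wedge2SumZero E) {K : Submodule ℂ (ι → ℂ)}
    (hK : ∀ y a, rowVec E y a ∈ K) {N : Submodule ℂ (Fin n → ℂ)} {Z : Submodule ℂ (ι → ℂ)}
    (hI : Inv E K N Z) {y₀ : Fin n → ℂ} (hy₀ : y₀ ∈ N) {j₀ : ι} (hj₀ : E j₀ *ᵥ y₀ ≠ 0) :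
    ∃ N' : Submodule ℂ (Fin n → ℂ), ∃ Z' : Submodule ℂ (ι → ℂ),
      Inv E K N' Z' ∧ Module.finrank ℂ Z + 1 ≤ Module.finrank ℂ Z' := by
  have hZU : SOrth (U E y₀) Z := hI.orth y₀ hy₀
  have hsup : Module.finrank ℂ ↥(Z ⊔ U E y₀) = Module.finrank ℂ Z + Module.finrank ℂ (U E y₀) :=
    finrank_sup_of_sOrth hZU.symm
  have hUpos : 1 ≤ Module.finrank ℂ (U E y₀) := by
    rw [Submodule.one_le_finrank_iff, Submodule.ne_bot_iff]
    have ha : ∃ a, (E j₀ *ᵥ y₀) a ≠ 0 := by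
      by_contra h
      push Not at h
      exact hj₀ (funext h)
    obtain ⟨a, ha⟩ := ha
    exact ⟨rowVec E y₀ a, Submodule.subset_span ⟨a, rfl⟩, fun h => ha (congr_fun h j₀)⟩
  have hrn : Module.finrank ℂ (LinearMap.range (L E y₀)) + Module.finrank ℂ (LinearMap.ker (L E y₀)) = n := by
    have h := LinearMap.finrank_range_add_finrank_ker (L E y₀)
    rwa [Module.finrank_fin_fun] at h
  have hRU : Module.finrank ℂ (LinearMap.range (L E y₀)) = Module.finrank ℂ (U E y₀) := finrank_range_L E y₀
  have hNK := Submodule.finrank_sup_add_finrank_inf_eq N (LinearMap.ker (L E y₀))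
  have hNK_le : Module.finrank ℂ ↥(N ⊔ LinearMap.ker (L E y₀)) ≤ n :=
    (Submodule.finrank_le _).trans (Module.finrank_fin_fun ℂ).le
  have hdim := hI.dim
  refine ⟨N ⊓ LinearMap.ker (L E y₀), Z ⊔ U E y₀, ⟨by omega, ?_, sup_le hI.le (U_le E hK y₀)⟩, by omega⟩
  intro y hy
  obtain ⟨hyN, hyker⟩ := Submodule.mem_inf.mp hy
  have hN' : ∀ j, star y₀ ⬝ᵥ (E j *ᵥ y) = 0 := by
    intro j
    rw [dot_herm E hE j y y₀]
    exact (mem_ker_L E).mp hyker j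
  exact sOrth_sup (hI.orth y hyN) (sOrth_span fun a b => fact2 E hE h2 hN' a b)

/-- THEOREM RL∞, strong form (memo §1): `dim J ≤ dim K` for every `K ≤ ℂ^ι` containing all row vectors `(j ↦ (E_j y)_a)`. -/
theorem finrank_J_le (hE : ∀ j, (E j).IsHermitian) (h2 : Wedge2SumZero E) (K : Submodule ℂ (ι → ℂ))
    (hK : ∀ y a, rowVec E y a ∈ K) : Module.finrank ℂ (J E) ≤ Module.finrank ℂ K := by
  have key : ∀ k : ℕ, (∃ N : Submodule ℂ (Fin n → ℂ), ∃ Z : Submodule ℂ (ι → ℂ),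
      Inv E K N Z ∧ k ≤ Module.finrank ℂ Z) ∨ Module.finrank ℂ (J E) ≤ Module.finrank ℂ K := by
    intro k
    induction k with
    | zero => exact Or.inl ⟨⊤, ⊥, inv_init E K, Nat.zero_le _⟩
    | succ k ih =>
      rcases ih with ⟨N, Z, hI, hk⟩ | h
      · by_cases hterm : ∀ y ∈ N, ∀ j, E j *ᵥ y = 0
        · exact Or.inr ((terminal E hE hI hterm).trans (Submodule.finrank_mono hI.le))
        · push Not at hterm
          obtain ⟨y₀, hy₀, j₀, hj₀⟩ := hterm
          obtain ⟨N', Z', hI', hZ'⟩ := step E hE h2 hK hI hy₀ hj₀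
          exact Or.inl ⟨N', Z', hI', by omega⟩
      · exact Or.inr h
  rcases key (Module.finrank ℂ K + 1) with ⟨N, Z, hI, hk⟩ | h
  · have := Submodule.finrank_mono hI.le
    omega
  · exact h

/-- RL∞: `dim J ≤ |ι|` (the number of matrices). -/
theorem finrank_J_le_card (hE : ∀ j, (E j).IsHermitian) (h2 : Wedge2SumZero E) :
    Module.finrank ℂ (J E) ≤ Fintype.card ι := by
  have h := finrank_J_le E hE h2 ⊤ (fun _ _ => Submodule.mem_top)
  rwa [finrank_top, Module.finrank_fintype_fun_eq_card] at h

/-- RL∞, `m′`-form: `dim J ≤ dim span{(j ↦ (E_j)_{ac}) : a, c}` (the row space of the `n² × ι` matrix `[vec E_j]_j`, whose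
dimension is `dim_ℂ span_ℂ {E_j}`). -/
theorem finrank_J_le_rowSpace (hE : ∀ j, (E j).IsHermitian) (h2 : Wedge2SumZero E) :
    Module.finrank ℂ (J E) ≤
      Module.finrank ℂ (Submodule.span ℂ (Set.range fun ac : Fin n × Fin n => fun j => E j ac.1 ac.2)) := by
  refine finrank_J_le E hE h2 _ fun y a => ?_
  have hrow : rowVec E y a = ∑ c, y c • (fun j => E j a c) := by
    funext j
    simp only [rowVec, Finset.sum_apply, Pi.smul_apply, smul_eq_mul]
    show (E j *ᵥ y) a = _
    rw [show (E j *ᵥ y) a = ∑ c, E j a c * y c from rfl]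
    exact Finset.sum_congr rfl fun c _ => mul_comm _ _
  rw [hrow]
  exact Submodule.sum_mem _ fun c _ => Submodule.smul_mem _ _ (Submodule.subset_span ⟨(a, c), rfl⟩)

omit [Fintype ι] in
theorem range_le_J (j : ι) : LinearMap.range (Matrix.mulVecLin (E j)) ≤ J E :=
  le_iSup (fun j => LinearMap.range (Matrix.mulVecLin (E j))) j

theorem range_sum_smul_le (c : ι → ℂ) : LinearMap.range (Matrix.mulVecLin (∑ i, c i • E i)) ≤ J E := by
  rintro _ ⟨v, rfl⟩
  rw [Matrix.mulVecLin_apply, Matrix.sum_mulVec]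
  refine Submodule.sum_mem _ fun i _ => ?_
  rw [Matrix.smul_mulVec]
  exact Submodule.smul_mem _ _ (Submodule.mem_iSup_of_mem i (LinearMap.mem_range_self _ v))

/-- RL∞ for combinations: every COMPLEX combination `Σ c_j E_j` has rank ≤ |ι|. -/
theorem rank_sum_smul_le (hE : ∀ j, (E j).IsHermitian) (h2 : Wedge2SumZero E) (c : ι → ℂ) :
    (∑ i, c i • E i).rank ≤ Fintype.card ι :=
  (Submodule.finrank_mono (range_sum_smul_le E c)).trans (finrank_J_le_card E hE h2)

omit [Fintype ι] in
/-- every single `E_j` has rank ≤ dim J. -/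
theorem rank_le_finrank_J (j : ι) : (E j).rank ≤ Module.finrank ℂ (J E) :=
  Submodule.finrank_mono (range_le_J E j)

end Core

section Consequences

/-- THE RANK LEMMA HOLDS FOR ALL `m` AND `n` (g23 memo conjectured `m ≥ 6`; its `m ≤ 5` pen proof used the LLD theorem — not needed). -/
theorem rankLemma_all (m n : ℕ) : RankLemma m n := by
  intro E hE h2 c
  simpa using rank_sum_smul_le E hE h2 (fun i => (c i : ℂ))

theorem rankLemmaUpToFive_holds : RankLemmaUpToFive := fun m n _ => rankLemma_all m n

theorem rankLemmaUpToThree_holds : RankLemmaUpToThree := fun m n _ => rankLemma_all m n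

/-- the linear functional `v ↦ Σ_j v_j` on `ℂ^ι`. -/
def sumFunctional (ι : Type*) [Fintype ι] : (ι → ℂ) →ₗ[ℂ] ℂ where
  toFun v := ∑ j, v j
  map_add' v w := by simp [Finset.sum_add_distrib]
  map_smul' c v := by simp [Finset.mul_sum]

theorem finrank_ker_sumFunctional_lt (ι : Type*) [Fintype ι] [Nonempty ι] :
    Module.finrank ℂ (LinearMap.ker (sumFunctional ι)) < Fintype.card ι := by
  classical
  obtain ⟨i⟩ := ‹Nonempty ι›
  have hne : LinearMap.ker (sumFunctional ι) ≠ ⊤ := by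
    intro htop
    have hmem : (Pi.single i (1 : ℂ) : ι → ℂ) ∈ LinearMap.ker (sumFunctional ι) := htop ▸ Submodule.mem_top
    rw [LinearMap.mem_ker] at hmem
    simp [sumFunctional] at hmem
  have h := Submodule.finrank_lt hne
  rwa [Module.finrank_fintype_fun_eq_card] at h

/-- four Hermitian roots with `Σ D_j = 0`, `Σ∧²D_j = 0` have joint range of dimension ≤ 3 … -/
theorem finrank_J_le_three {n : ℕ} (D : Fin 4 → Matrix (Fin n) (Fin n) ℂ) (hD : ∀ j, (D j).IsHermitian)
    (hsum : ∑ j, D j = 0) (h2 : Wedge2SumZero D) : Module.finrank ℂ (J D) ≤ 3 := by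
  have hK : ∀ y a, rowVec D y a ∈ LinearMap.ker (sumFunctional (Fin 4)) := by
    intro y a
    rw [LinearMap.mem_ker]
    show ∑ j, (D j *ᵥ y) a = 0
    rw [← Finset.sum_apply a Finset.univ (fun j => D j *ᵥ y), ← Matrix.sum_mulVec, hsum, Matrix.zero_mulVec]
    rfl
  have h := finrank_J_le D hD h2 _ hK
  have h' := finrank_ker_sumFunctional_lt (Fin 4)
  rw [Fintype.card_fin] at h'
  omega

/-- … hence every `D_j` has rank ≤ 3 and ALL 4×4 MINORS VANISH: `NoSplitWindow n` for every `n` (g23 memo §3, now kernel-checked and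
without the Gram re-basis). -/
theorem noSplitWindow_all (n : ℕ) : NoSplitWindow n := by
  intro D hD hsum h2 j r s
  have hJ := finrank_J_le_three D hD hsum h2
  have hrank : ((D j).submatrix r s).rank ≤ 3 :=
    calc ((D j).submatrix r s).rank ≤ (D j).rank := Matrix.rank_submatrix_le _ _ _
      _ ≤ Module.finrank ℂ (J D) := rank_le_finrank_J D j
      _ ≤ 3 := hJ
  by_contra hdet
  change ((D j).submatrix r s).det ≠ 0 at hdet
  have hU : IsUnit ((D j).submatrix r s) :=
    (Matrix.isUnit_iff_isUnit_det _).mpr (isUnit_iff_ne_zero.mpr hdet)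
  have h4 := Matrix.rank_of_isUnit _ hU
  rw [Fintype.card_fin] at h4
  omega

theorem nswReduction_all (n : ℕ) : NSWReduction n := fun _ => noSplitWindow_all n

/-- COROLLARY NSW, now UNCONDITIONAL: no Hermitian family is a numerically split point of the WNSH-LF window. -/
theorem not_splitWNSH {n : ℕ} (D : Fin 4 → Matrix (Fin n) (Fin n) ℂ) (herm : ∀ j, (D j).IsHermitian) :
    ¬ SplitWNSH D :=
  not_splitWNSH_of_noSplitWindow (noSplitWindow_all n) D herm

end Consequences

end HSemireg.C4HNWindow
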